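import Mathlib
import HarnessLib
import Summits.RiemannHypothesis.RiemannHypothesis.Theorems.IntegerScrewVarianceDecomp

/-!
# Route `IntegerScrew` — the martingale step of CONTINUUM-LIMIT §24 (LEMMA MR) in abstract form

One level of the TOP-DOWN MARTINGALE of CONTINUUM-LIMIT §24.3, for an arbitrary finite set `S ⊂ ℕ_{≥1}` closed
under division by a prime `p` (in the application: an atom `{b·p^v : b p-smooth, b p^v ≤ R}` of the truncated
multiplicative walk, or all of `{1,…,M}`), with the harmonic weights `1/a` and a function `G`.  Split `S` into the
`p`-FIBRES `fib v = {a ∈ S : v_p(a) = v}` with weights `W v = Σ_{fib v} 1/a` and means `h v`; the BETWEEN-fibre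
variance `Σ_v W v (h v − h̄)²` (one term `T_k` of `Var = Σ_k T_k`, `sum_mul_sq_sub_eq_within_add_between`) is bounded by

* the MAIN term `Σ_{a∈S} (1/a) Σ_{d=1}^{v_p(a)} (G a − G(a/p^d))²` (the `p`-part of the Dirichlet form restricted to
  `S`, every death `a → a/p^d` once), times `1 + θ`, plus
* the ROOM term `Σ_{w<v} W v · (mean_{fib w} G − mean_{small(w,v)} G)²` times `1 + 1/θ`, where
  `small(w,v) = {a ∈ fib w : a·p^{v−w} ∈ S}` is the part of the `w`-fibre that still fits at level `v`
  (for `S = {1,…,M}`-atoms: the complement of the top WINDOW of ratio `p^{v−w}`); the ROOM term vanishes when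
  `S` is also closed under multiplication by `p` (no truncation) — it is the only place where `x ≤ M` enters.

Main result **`between_fibre_variance_le`** (LEMMA MR of §24.3, abstract form); ingredients `sum_fib_eq_sum_small`
(the bijection `a ↦ a/p^d` from `fib v` onto `small(w,v)`), `sq_mean_sub_mean_le` (Jensen along it), and the generic
`sum_sq_sub_mean_le_pair_sum'` of `IntegerScrewVarianceDecomp`.  RH-free, elementary.

References: CONTINUUM-LIMIT §24 (rh-explicit A6-PIVOT); M. Suzuki, J. Lond. Math. Soc. (2) 108 (2023) 1448–1487
[Suzuki2023].
-/

noncomputable section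

set_option linter.dupNamespace false -- D-0017: `Summit.<S>.<S>.…` is the designed namespace

namespace Summit.RiemannHypothesis.RiemannHypothesis.Theorems.IntegerScrew

open Finset

/-! ### Closure under division by `p^d` and the fibre bijection -/

/-- If `S` is closed under `a ↦ a/p` (`p ∣ a`), it is closed under `a ↦ a/p^d` (`p^d ∣ a`). -/
theorem div_pow_mem_of_div_mem {S : Finset ℕ} {p : ℕ} (hp : p.Prime)
    (hdiv : ∀ a ∈ S, p ∣ a → a / p ∈ S) {a : ℕ} (ha : a ∈ S) {d : ℕ} (hd : p ^ d ∣ a) :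
    a / p ^ d ∈ S := by
  induction d generalizing a with
  | zero => simpa using ha
  | succ d ih =>
    have hpd : p ^ d ∣ a := (pow_dvd_pow p (Nat.le_succ d)).trans hd
    have h1 : a / p ^ d ∈ S := ih ha hpd
    have hpdiv : p ∣ a / p ^ d := by
      obtain ⟨c, rfl⟩ := hd
      rw [pow_succ, mul_assoc, Nat.mul_div_cancel_left _ (pow_pos hp.pos d)]
      exact dvd_mul_right p c
    have := hdiv _ h1 hpdiv
    rwa [Nat.div_div_eq_div_mul, ← pow_succ] at this

/-- The map `a ↦ a/p^d` is a bijection from the fibre `{a ∈ S : v_p a = w + d}` onto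
`{a' ∈ S : v_p a' = w, a'·p^d ∈ S}`; hence sums transfer. -/
theorem sum_fib_eq_sum_small {S : Finset ℕ} {p : ℕ} (hp : p.Prime) (hS : ∀ a ∈ S, 1 ≤ a)
    (hdiv : ∀ a ∈ S, p ∣ a → a / p ∈ S) (w d : ℕ) (F : ℕ → ℝ) :
    ∑ a ∈ S with a.factorization p = w + d, F a =
      ∑ a' ∈ (S.filter (fun a' => a'.factorization p = w)) with a' * p ^ d ∈ S, F (a' * p ^ d) := by
  refine Finset.sum_nbij' (fun a => a / p ^ d) (fun a' => a' * p ^ d) ?_ ?_ ?_ ?_ ?_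
  · intro a ha
    obtain ⟨haS, hav⟩ := mem_filter.1 ha
    have ha0 : a ≠ 0 := by have := hS a haS; omega
    have hdvd : p ^ d ∣ a := (hp.pow_dvd_iff_le_factorization ha0).2 (by omega)
    have hdec : a / p ^ d * p ^ d = a := Nat.div_mul_cancel hdvd
    refine mem_filter.2 ⟨mem_filter.2 ⟨div_pow_mem_of_div_mem hp hdiv haS hdvd, ?_⟩, by rw [hdec]; exact haS⟩
    rw [Nat.factorization_div hdvd, Finsupp.tsub_apply, Nat.factorization_pow_self hp, hav]
    omega
  · intro a' ha'
    obtain ⟨ha'f, ha'S⟩ := mem_filter.1 ha'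
    obtain ⟨ha'S0, ha'w⟩ := mem_filter.1 ha'f
    have ha'0 : a' ≠ 0 := by have := hS a' ha'S0; omega
    refine mem_filter.2 ⟨ha'S, ?_⟩
    rw [Nat.factorization_mul ha'0 (pow_ne_zero d hp.ne_zero), Finsupp.add_apply, Nat.factorization_pow_self hp,
      ha'w]
  · intro a ha
    obtain ⟨haS, hav⟩ := mem_filter.1 ha
    have ha0 : a ≠ 0 := by have := hS a haS; omega
    have hdvd : p ^ d ∣ a := (hp.pow_dvd_iff_le_factorization ha0).2 (by omega)
    exact Nat.div_mul_cancel hdvd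
  · intro a' _
    exact Nat.mul_div_cancel a' (pow_pos hp.pos d)
  · intro a ha
    obtain ⟨haS, hav⟩ := mem_filter.1 ha
    have ha0 : a ≠ 0 := by have := hS a haS; omega
    have hdvd : p ^ d ∣ a := (hp.pow_dvd_iff_le_factorization ha0).2 (by omega)
    simp only [Nat.div_mul_cancel hdvd]

/-! ### Jensen along the fibre bijection -/

/-- Cauchy–Schwarz for weighted means: `(Σ c x)² ≤ (Σ c)(Σ c x²)` for `c ≥ 0`. -/
theorem sq_sum_mul_le_sum_mul_sum_mul_sq (t : Finset ℕ) (c x : ℕ → ℝ) (hc : ∀ i ∈ t, 0 ≤ c i) :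
    (∑ i ∈ t, c i * x i) ^ 2 ≤ (∑ i ∈ t, c i) * ∑ i ∈ t, c i * x i ^ 2 := by
  have h := sum_sum_mul_sq_sub t c x
  have hnn : 0 ≤ ∑ i ∈ t, ∑ j ∈ t, c i * c j * (x i - x j) ^ 2 :=
    Finset.sum_nonneg fun i hi => Finset.sum_nonneg fun j hj =>
      mul_nonneg (mul_nonneg (hc i hi) (hc j hj)) (sq_nonneg _)
  linarith

/-- **Jensen along the bijection.**  With `small = {a' ∈ fib w : a' p^d ∈ S}`, `s₀ = Σ_small 1/a'`:
`s₀ · ((Σ_small G(a'p^d)/a')/s₀ − (Σ_small G(a')/a')/s₀)² ≤ Σ_small (1/a')(G(a'p^d) − G(a'))²`, i.e.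
`W_v·(h_v − A₁)² ≤ p^{−d}·Σ_small (1/a')(G(a'p^d) − G a')² = Σ_{fib v} (1/a)(G a − G(a/p^d))²`. -/
theorem mul_sq_mean_sub_mean_le (t : Finset ℕ) (ht : ∀ a ∈ t, 1 ≤ a) (G : ℕ → ℝ) (q : ℕ) :
    (∑ a ∈ t, 1 / (a : ℝ)) *
        ((∑ a ∈ t, 1 / (a : ℝ) * G (a * q)) / (∑ a ∈ t, 1 / (a : ℝ)) -
          (∑ a ∈ t, 1 / (a : ℝ) * G a) / (∑ a ∈ t, 1 / (a : ℝ))) ^ 2 ≤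
      ∑ a ∈ t, 1 / (a : ℝ) * (G (a * q) - G a) ^ 2 := by
  set s0 := ∑ a ∈ t, 1 / (a : ℝ) with hs0
  rcases t.eq_empty_or_nonempty with rfl | hne
  · simp
  · have hpos : 0 < s0 := Finset.sum_pos (fun a ha => by have := ht a ha; positivity) hne
    have hdiff : (∑ a ∈ t, 1 / (a : ℝ) * G (a * q)) / s0 - (∑ a ∈ t, 1 / (a : ℝ) * G a) / s0 =
        (∑ a ∈ t, 1 / (a : ℝ) * (G (a * q) - G a)) / s0 := by
      rw [← sub_div, ← Finset.sum_sub_distrib]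
      congr 1
      exact Finset.sum_congr rfl fun a _ => by ring
    rw [hdiff]
    set A := ∑ a ∈ t, 1 / (a : ℝ) * (G (a * q) - G a) with hA
    have hcs : A ^ 2 ≤ s0 * ∑ a ∈ t, 1 / (a : ℝ) * (G (a * q) - G a) ^ 2 :=
      sq_sum_mul_le_sum_mul_sum_mul_sq t (fun a => 1 / (a : ℝ)) (fun a => G (a * q) - G a)
        (fun a _ => by positivity)
    have heq : s0 * (A / s0) ^ 2 = A ^ 2 / s0 := by
      field_simp
    rw [heq, div_le_iff₀ hpos]
    calc A ^ 2 ≤ s0 * ∑ a ∈ t, 1 / (a : ℝ) * (G (a * q) - G a) ^ 2 := hcs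
      _ = (∑ a ∈ t, 1 / (a : ℝ) * (G (a * q) - G a) ^ 2) * s0 := mul_comm _ _

/-! ### The martingale step (LEMMA MR, abstract form) -/

/-- Elementary: `(a − b)² ≤ (1+θ)a² + (1+1/θ)b²` for `θ > 0`. -/
theorem sq_sub_le_theta (a b : ℝ) {θ : ℝ} (hθ : 0 < θ) :
    (a - b) ^ 2 ≤ (1 + θ) * a ^ 2 + (1 + 1 / θ) * b ^ 2 := by
  have h : 0 ≤ (θ * a + b) ^ 2 / θ := div_nonneg (sq_nonneg _) hθ.le
  have hexp : (1 + θ) * a ^ 2 + (1 + 1 / θ) * b ^ 2 - (a - b) ^ 2 = (θ * a + b) ^ 2 / θ := by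
    field_simp
    ring
  linarith

/-- For non-negative `F`, summing `F (v − w)` over the `w < v` of any finite set is at most `Σ_{d=1}^{v} F d`. -/
theorem sum_filter_lt_le_sum_Icc (V : Finset ℕ) (v : ℕ) (F : ℕ → ℝ) (hF : ∀ d, 0 ≤ F d) :
    ∑ w ∈ V with w < v, F (v - w) ≤ ∑ d ∈ Icc 1 v, F d := by
  have hinj : Set.InjOn (fun w => v - w) ↑(V.filter (fun w => w < v)) := by
    intro w₁ hw₁ w₂ hw₂ h
    have h1 := (mem_filter.1 (Finset.mem_coe.1 hw₁)).2
    have h2 := (mem_filter.1 (Finset.mem_coe.1 hw₂)).2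
    simp only at h
    omega
  rw [← Finset.sum_image (f := F) hinj]
  refine Finset.sum_le_sum_of_subset_of_nonneg ?_ (fun d _ _ => hF d)
  intro d hd
  obtain ⟨w, hw, rfl⟩ := Finset.mem_image.1 hd
  have := (mem_filter.1 hw).2
  exact mem_Icc.2 ⟨by omega, by omega⟩

/-- **The martingale step (CONTINUUM-LIMIT §24.3, LEMMA MR, abstract form).**  Let `S ⊂ ℕ_{≥1}` be finite and closed
under division by the prime `p`; put `fib v = {a ∈ S : v_p(a) = v}`, `W v = Σ_{fib v} 1/a`, and let `avg T` denote the
`1/a`-weighted mean of `G` over `T`.  Then for every `θ > 0` the between-fibre variance satisfies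
`Σ_v W v·(avg (fib v) − avg S)² ≤ (1+θ)·Σ_{a∈S}(1/a)Σ_{d=1}^{v_p a}(G a − G(a/p^d))²`
`  + (1+1/θ)·Σ_{w<v} W v·(avg (fib w) − avg {a ∈ fib w : a p^{v−w} ∈ S})²`
(MAIN + ROOM; the ROOM term vanishes if `S` is also closed under multiplication by `p`). -/
theorem between_fibre_variance_le {S : Finset ℕ} {p : ℕ} (hp : p.Prime) (hS : ∀ a ∈ S, 1 ≤ a)
    (hdiv : ∀ a ∈ S, p ∣ a → a / p ∈ S) (G : ℕ → ℝ) {θ : ℝ} (hθ : 0 < θ) :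
    ∑ v ∈ S.image (fun a => a.factorization p),
        (∑ a ∈ S with a.factorization p = v, 1 / (a : ℝ)) *
          ((∑ a ∈ S with a.factorization p = v, 1 / (a : ℝ) * G a) /
              (∑ a ∈ S with a.factorization p = v, 1 / (a : ℝ)) -
            (∑ a ∈ S, 1 / (a : ℝ) * G a) / (∑ a ∈ S, 1 / (a : ℝ))) ^ 2 ≤
      (1 + θ) * ∑ a ∈ S, 1 / (a : ℝ) * ∑ d ∈ Icc 1 (a.factorization p), (G a - G (a / p ^ d)) ^ 2 +
      (1 + 1 / θ) * ∑ v ∈ S.image (fun a => a.factorization p),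
        ∑ w ∈ S.image (fun a => a.factorization p) with w < v,
          (∑ a ∈ S with a.factorization p = v, 1 / (a : ℝ)) *
            ((∑ a ∈ S with a.factorization p = w, 1 / (a : ℝ) * G a) /
                (∑ a ∈ S with a.factorization p = w, 1 / (a : ℝ)) -
              (∑ a ∈ (S.filter (fun a => a.factorization p = w)) with a * p ^ (v - w) ∈ S, 1 / (a : ℝ) * G a) /
                (∑ a ∈ (S.filter (fun a => a.factorization p = w)) with a * p ^ (v - w) ∈ S, 1 / (a : ℝ))) ^ 2 := by
  -- notation
  set V := S.image (fun a => a.factorization p) with hV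
  set W : ℕ → ℝ := fun v => ∑ a ∈ S with a.factorization p = v, 1 / (a : ℝ) with hW
  set N : ℕ → ℝ := fun v => ∑ a ∈ S with a.factorization p = v, 1 / (a : ℝ) * G a with hN
  set h : ℕ → ℝ := fun v => N v / W v with hh
  have hmaps : ∀ a ∈ S, a.factorization p ∈ V := fun a ha => mem_image_of_mem _ ha
  have hWnn : ∀ v, 0 ≤ W v := fun v => Finset.sum_nonneg fun a _ => by positivity
  have hWpos : ∀ v ∈ V, 0 < W v := by
    intro v hv
    obtain ⟨a, ha, rfl⟩ := Finset.mem_image.1 hv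
    exact Finset.sum_pos (fun b hb => by have := hS b (mem_filter.1 hb).1; positivity)
      ⟨a, mem_filter.2 ⟨ha, rfl⟩⟩
  -- the grand mean is the W-weighted mean of the fibre means
  have hsumW : ∑ v ∈ V, W v = ∑ a ∈ S, 1 / (a : ℝ) := by
    simp only [hW]; exact Finset.sum_fiberwise_of_maps_to hmaps _
  have hsumN : ∑ v ∈ V, W v * h v = ∑ a ∈ S, 1 / (a : ℝ) * G a := by
    rw [← Finset.sum_fiberwise_of_maps_to hmaps (fun a => 1 / (a : ℝ) * G a)]
    refine Finset.sum_congr rfl fun v hv => ?_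
    simp only [hh, hN]
    rw [mul_div_cancel₀ _ (hWpos v hv).ne']
  -- empty case
  rcases S.eq_empty_or_nonempty with hSe | hSne
  · subst hSe; simp
  have hVpos : 0 < ∑ v ∈ V, W v := by
    rw [hsumW]; exact Finset.sum_pos (fun a ha => by have := hS a ha; positivity) hSne
  -- Step 1: the abstract one-dimensional step
  have step1 : ∑ v ∈ V, W v * (h v - (∑ a ∈ S, 1 / (a : ℝ) * G a) / (∑ a ∈ S, 1 / (a : ℝ))) ^ 2 ≤
      ∑ v ∈ V, ∑ w ∈ V with w < v, W v * (h v - h w) ^ 2 := by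
    have := sum_sq_sub_mean_le_pair_sum' V W h (fun v _ => hWnn v) hVpos
    rwa [hsumN, hsumW] at this
  -- Step 2: termwise MAIN/ROOM split
  have step2 : ∀ v ∈ V, ∀ w ∈ V.filter (fun w => w < v),
      W v * (h v - h w) ^ 2 ≤
        (1 + θ) * ∑ a ∈ S with a.factorization p = v, 1 / (a : ℝ) * (G a - G (a / p ^ (v - w))) ^ 2 +
        (1 + 1 / θ) * (W v * (h w -
          (∑ a ∈ (S.filter (fun a => a.factorization p = w)) with a * p ^ (v - w) ∈ S, 1 / (a : ℝ) * G a) /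
            (∑ a ∈ (S.filter (fun a => a.factorization p = w)) with a * p ^ (v - w) ∈ S, 1 / (a : ℝ))) ^ 2) := by
    intro v hv w hw
    obtain ⟨hwV, hwv⟩ := mem_filter.1 hw
    obtain ⟨d, rfl⟩ : ∃ d, v = w + d := ⟨v - w, by omega⟩
    have hd : w + d - w = d := by omega
    rw [hd]
    set T := (S.filter (fun a => a.factorization p = w)).filter (fun a => a * p ^ d ∈ S) with hT
    set A1 := (∑ a ∈ T, 1 / (a : ℝ) * G a) / (∑ a ∈ T, 1 / (a : ℝ)) with hA1
    have hT1 : ∀ a ∈ T, 1 ≤ a := fun a ha => hS a (mem_filter.1 (mem_filter.1 ha).1).1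
    -- the bijection transfers W (w+d), N (w+d) and the MAIN sum to T
    have hp0 : (0 : ℝ) < (p : ℝ) := by exact_mod_cast hp.pos
    have hq0 : (0 : ℝ) < (p : ℝ) ^ d := pow_pos hp0 d
    have hWv : W (w + d) = (1 / (p : ℝ) ^ d) * ∑ a ∈ T, 1 / (a : ℝ) := by
      simp only [hW, hT]
      rw [sum_fib_eq_sum_small hp hS hdiv w d (fun a => 1 / (a : ℝ)), Finset.mul_sum]
      refine Finset.sum_congr rfl fun a _ => ?_
      push_cast; rw [one_div_mul_one_div, mul_comm]
    have hNv : N (w + d) = (1 / (p : ℝ) ^ d) * ∑ a ∈ T, 1 / (a : ℝ) * G (a * p ^ d) := by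
      simp only [hN, hT]
      rw [sum_fib_eq_sum_small hp hS hdiv w d (fun a => 1 / (a : ℝ) * G a), Finset.mul_sum]
      refine Finset.sum_congr rfl fun a _ => ?_
      push_cast; rw [← mul_assoc, one_div_mul_one_div, mul_comm ((a : ℝ))]
    have hMv : ∑ a ∈ S with a.factorization p = w + d, 1 / (a : ℝ) * (G a - G (a / p ^ d)) ^ 2 =
        (1 / (p : ℝ) ^ d) * ∑ a ∈ T, 1 / (a : ℝ) * (G (a * p ^ d) - G a) ^ 2 := by
      simp only [hT]
      rw [sum_fib_eq_sum_small hp hS hdiv w d (fun a => 1 / (a : ℝ) * (G a - G (a / p ^ d)) ^ 2),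
        Finset.mul_sum]
      refine Finset.sum_congr rfl fun a _ => ?_
      rw [Nat.mul_div_cancel a (pow_pos hp.pos d)]
      push_cast; rw [← mul_assoc, one_div_mul_one_div, mul_comm ((a : ℝ))]
    -- h (w+d) = avg over T of G(· p^d)
    have hhv : h (w + d) = (∑ a ∈ T, 1 / (a : ℝ) * G (a * p ^ d)) / (∑ a ∈ T, 1 / (a : ℝ)) := by
      simp only [hh]
      rw [hNv, hWv, mul_div_mul_left _ _ (by positivity : (1 / (p : ℝ) ^ d) ≠ 0)]
    -- Jensen: W v (h v − A1)² ≤ MAIN_v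
    have hjensen : W (w + d) * (h (w + d) - A1) ^ 2 ≤
        ∑ a ∈ S with a.factorization p = w + d, 1 / (a : ℝ) * (G a - G (a / p ^ d)) ^ 2 := by
      rw [hMv, hWv, hhv, hA1, mul_assoc]
      exact mul_le_mul_of_nonneg_left (mul_sq_mean_sub_mean_le T hT1 G (p ^ d)) (by positivity)
    -- split
    have hsplit := sq_sub_le_theta (h (w + d) - A1) (h w - A1) hθ
    have hrew : h (w + d) - h w = (h (w + d) - A1) - (h w - A1) := by ring
    calc W (w + d) * (h (w + d) - h w) ^ 2
        = W (w + d) * ((h (w + d) - A1) - (h w - A1)) ^ 2 := by rw [hrew]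
      _ ≤ W (w + d) * ((1 + θ) * (h (w + d) - A1) ^ 2 + (1 + 1 / θ) * (h w - A1) ^ 2) :=
          mul_le_mul_of_nonneg_left hsplit (hWnn _)
      _ = (1 + θ) * (W (w + d) * (h (w + d) - A1) ^ 2) + (1 + 1 / θ) * (W (w + d) * (h w - A1) ^ 2) := by ring
      _ ≤ (1 + θ) * (∑ a ∈ S with a.factorization p = w + d, 1 / (a : ℝ) * (G a - G (a / p ^ d)) ^ 2) +
            (1 + 1 / θ) * (W (w + d) * (h w - A1) ^ 2) := by
          have h1θ : 0 ≤ 1 + θ := by linarith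
          nlinarith [mul_le_mul_of_nonneg_left hjensen h1θ]
  -- Step 3: sum the MAIN parts over w < v and regroup over a ∈ S
  have step3 : ∀ v ∈ V,
      ∑ w ∈ V with w < v, ∑ a ∈ S with a.factorization p = v, 1 / (a : ℝ) * (G a - G (a / p ^ (v - w))) ^ 2 ≤
        ∑ a ∈ S with a.factorization p = v, 1 / (a : ℝ) * ∑ d ∈ Icc 1 (a.factorization p), (G a - G (a / p ^ d)) ^ 2 := by
    intro v hv
    rw [Finset.sum_comm]
    refine Finset.sum_le_sum fun a ha => ?_
    rw [← Finset.mul_sum, (mem_filter.1 ha).2]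
    refine mul_le_mul_of_nonneg_left ?_ (by positivity)
    exact sum_filter_lt_le_sum_Icc V v (fun d => (G a - G (a / p ^ d)) ^ 2) (fun d => sq_nonneg _)
  -- assemble
  calc ∑ v ∈ V, W v * (h v - (∑ a ∈ S, 1 / (a : ℝ) * G a) / (∑ a ∈ S, 1 / (a : ℝ))) ^ 2
      ≤ ∑ v ∈ V, ∑ w ∈ V with w < v, W v * (h v - h w) ^ 2 := step1
    _ ≤ ∑ v ∈ V, ∑ w ∈ V with w < v,
          ((1 + θ) * ∑ a ∈ S with a.factorization p = v, 1 / (a : ℝ) * (G a - G (a / p ^ (v - w))) ^ 2 +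
           (1 + 1 / θ) * (W v * (h w -
            (∑ a ∈ (S.filter (fun a => a.factorization p = w)) with a * p ^ (v - w) ∈ S, 1 / (a : ℝ) * G a) /
              (∑ a ∈ (S.filter (fun a => a.factorization p = w)) with a * p ^ (v - w) ∈ S, 1 / (a : ℝ))) ^ 2)) :=
        Finset.sum_le_sum fun v hv => Finset.sum_le_sum fun w hw => step2 v hv w hw
    _ = (1 + θ) * ∑ v ∈ V, ∑ w ∈ V with w < v,
            ∑ a ∈ S with a.factorization p = v, 1 / (a : ℝ) * (G a - G (a / p ^ (v - w))) ^ 2 +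
        (1 + 1 / θ) * ∑ v ∈ V, ∑ w ∈ V with w < v, W v * (h w -
            (∑ a ∈ (S.filter (fun a => a.factorization p = w)) with a * p ^ (v - w) ∈ S, 1 / (a : ℝ) * G a) /
              (∑ a ∈ (S.filter (fun a => a.factorization p = w)) with a * p ^ (v - w) ∈ S, 1 / (a : ℝ))) ^ 2 := by
        rw [Finset.mul_sum, Finset.mul_sum, ← Finset.sum_add_distrib]
        refine Finset.sum_congr rfl fun v _ => ?_
        rw [Finset.mul_sum, Finset.mul_sum, ← Finset.sum_add_distrib]
    _ ≤ (1 + θ) * ∑ a ∈ S, 1 / (a : ℝ) * ∑ d ∈ Icc 1 (a.factorization p), (G a - G (a / p ^ d)) ^ 2 +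
        (1 + 1 / θ) * ∑ v ∈ V, ∑ w ∈ V with w < v, W v * (h w -
            (∑ a ∈ (S.filter (fun a => a.factorization p = w)) with a * p ^ (v - w) ∈ S, 1 / (a : ℝ) * G a) /
              (∑ a ∈ (S.filter (fun a => a.factorization p = w)) with a * p ^ (v - w) ∈ S, 1 / (a : ℝ))) ^ 2 := by
        have h1θ : 0 ≤ 1 + θ := by linarith
        have hmain : ∑ v ∈ V, ∑ w ∈ V with w < v,
            ∑ a ∈ S with a.factorization p = v, 1 / (a : ℝ) * (G a - G (a / p ^ (v - w))) ^ 2 ≤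
            ∑ a ∈ S, 1 / (a : ℝ) * ∑ d ∈ Icc 1 (a.factorization p), (G a - G (a / p ^ d)) ^ 2 := by
          rw [← Finset.sum_fiberwise_of_maps_to hmaps
            (fun a => 1 / (a : ℝ) * ∑ d ∈ Icc 1 (a.factorization p), (G a - G (a / p ^ d)) ^ 2)]
          exact Finset.sum_le_sum fun v hv => step3 v hv
        have := mul_le_mul_of_nonneg_left hmain h1θ
        linarith

end Summit.RiemannHypothesis.RiemannHypothesis.Theorems.IntegerScrew

end
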